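import Summits.Schanuel.Schanuel.Theorems.ZilberEacParamSurfaceCurvedRealComplete
import Literature.ModelTheory.Zilber.EACDensityNonFree
import HarnessLib

/-!
# Polynomially parametrised base curves, XXXVII: `GL₂(ℤ)`-transport of the base curve and the
# RATIONAL leading ratio

HONEST FRAMING.  Cell `pub-schanuel` (Zilber's Exponential-Algebraic Closedness, case ladder;
host summit Schanuel), seat 2, gen 21.  Bookkeeping, no new analysis.  Mantova–Masser's case
(dim-π-S-1-free) and the density of the exponential points are both invariant under the monomial
changes `(x, y) ↦ (U x, y^U)`, `U ∈ GL₂(ℤ)` (`mmCaseDimPiOneFree_latticeClosure`,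
`unprojectedDense_latticeClosure_iff`, Literature), and the base curve `cl π(W ∩ G²)` moves by
`x ↦ U x` (`zeroLocus_vanishingIdeal_image_intLinMap`).  Hence a theorem "every `W` of the case
over the base curve `U · B` is dense" gives the same over `B`
(`unprojectedDense_of_mmCase_of_base_transport`).  For a polynomially parametrised base
`B = {(g₀(t), g₁(t))}` with `deg g₀ = deg g₁ = n` and RATIONAL leading ratio, written
`p lc(g₀) + q lc(g₁) = 0` with `p u + q v = 1`, the first row of the Bezout matrix
`(p q; -v u) ∈ SL₂(ℤ)` (Literature's `bezoutMat`) kills the leading term: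
`U · B = {(G(t), H(t))}` with `G = p g₀ + q g₁` of degree `< n` and `H = u g₁ - v g₀` of degree
`n`, so the rational-ratio case REDUCES to unequal degrees, where the master capstone of file
XXXVI applies (`unprojectedDense_of_mmCase_of_base_eq_paramCurve_of_ratRatio`); unconditionally
when `deg G ≥ 2` does not divide `n` (`…_of_ratRatio_of_not_dvd`), e.g. EVERY `W` of the case
over `(x₁ - x₀)³ = x₀²`.  What stays OPEN: the residual classes of the reduced pair
(vanishing phase with proportional sub-leading coefficients; `deg G = 1` is a graph base, decided
off the equimodular class in gen 18); general algebraic curves; Fib(3,2); EC(3,2).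
Mantova–Masser's question is OPEN in general (PLMS 2024 §1 p. 5); NOT Schanuel's conjecture
(neither used nor implied; EAC ⇏ SC).
-/

noncomputable section

open Filter Topology Set Complex MvPolynomial
open Literature.NumberTheory.Transcendental Literature.ModelTheory.Zilber
open Literature.ModelTheory.ExponentialFields

set_option linter.dupNamespace false

namespace Summit.Schanuel.Schanuel.Theorems

/-! ## Part A. Transport of "every `W` of the case over the base `B` is dense" -/

/-- **`GL₂(ℤ)`-transport of the base curve.**  `U V = V U = 1`.  If every `W'` of
Mantova–Masser's case with base curve `cl π(W' ∩ G²) = U · B` has Zariski-dense exponential points,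
then so does every `W` of the case with base curve `B`: take `W' = W^U` (the Zariski closure of
`Φ_U(W ∩ G²)`), which is in the case, has base `U · B`, and is dense iff `W` is. (new) -/
theorem unprojectedDense_of_mmCase_of_base_transport {U V : Matrix (Fin 2) (Fin 2) ℤ}
    (hUV : U * V = 1) (hVU : V * U = 1) (B : Set (Fin 2 → ℂ))
    (h : ∀ W' : Set (Fin 2 ⊕ Fin 2 → ℂ), MMCaseDimPiOneFree W' →
      zeroLocus ℂ (vanishingIdeal ℂ (projAdd '' (W' ∩ torusLocus ℂ 2))) = intLinMap U '' B →
      UnprojectedDense W')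
    {W : Set (Fin 2 ⊕ Fin 2 → ℂ)} (hmm : MMCaseDimPiOneFree W)
    (hbase : zeroLocus ℂ (vanishingIdeal ℂ (projAdd '' (W ∩ torusLocus ℂ 2))) = B) :
    UnprojectedDense W := by
  have hmm' : MMCaseDimPiOneFree (latticeClosure U W) := mmCaseDimPiOneFree_latticeClosure hUV hVU hmm
  have hT : latticeClosure U W ∩ torusLocus ℂ 2 = latticeImage U W :=
    latticeClosure_inter_torusLocus hUV hVU hmm.1.1
  have hbase' : zeroLocus ℂ (vanishingIdeal ℂ (projAdd '' (latticeClosure U W ∩ torusLocus ℂ 2))) =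
      intLinMap U '' B := by
    rw [hT, projAdd_image_latticeImage, zeroLocus_vanishingIdeal_image_intLinMap hUV hVU, hbase]
  exact (unprojectedDense_latticeClosure_iff hUV hVU hmm.1 hmm.2.1).1 (h _ hmm' hbase')

/-- The image of a polynomially parametrised curve under `x ↦ U x` is the polynomially
parametrised curve of the `U`-combinations. (new) -/
theorem intLinMap_image_paramCurve (U : Matrix (Fin 2) (Fin 2) ℤ) (g₀ g₁ : Polynomial ℂ) :
    intLinMap U '' {x : Fin 2 → ℂ | ∃ t : ℂ, x 0 = g₀.eval t ∧ x 1 = g₁.eval t} =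
      {x : Fin 2 → ℂ | ∃ t : ℂ,
        x 0 = (Polynomial.C ((U 0 0 : ℤ) : ℂ) * g₀ + Polynomial.C ((U 0 1 : ℤ) : ℂ) * g₁).eval t ∧
        x 1 = (Polynomial.C ((U 1 0 : ℤ) : ℂ) * g₀ + Polynomial.C ((U 1 1 : ℤ) : ℂ) * g₁).eval t} := by
  ext x
  simp only [Set.mem_image, Set.mem_setOf_eq, Polynomial.eval_add, Polynomial.eval_mul,
    Polynomial.eval_C]
  constructor
  · rintro ⟨x', ⟨t, h0, h1⟩, rfl⟩
    exact ⟨t, by simp [intLinMap, Fin.sum_univ_two, h0, h1],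
      by simp [intLinMap, Fin.sum_univ_two, h0, h1]⟩
  · rintro ⟨t, h0, h1⟩
    refine ⟨![g₀.eval t, g₁.eval t], ⟨t, by simp, by simp⟩, ?_⟩
    funext i
    fin_cases i
    · simp [intLinMap, Fin.sum_univ_two, h0]
    · simp [intLinMap, Fin.sum_univ_two, h1]

/-- **Transport for polynomially parametrised bases.**  If every `W'` of the case over
`{(U₀₀ g₀ + U₀₁ g₁, U₁₀ g₀ + U₁₁ g₁)(t)}` is dense (`U ∈ GL₂(ℤ)`), then every `W` of the case over
`{(g₀(t), g₁(t))}` is dense. (new) -/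
theorem unprojectedDense_of_mmCase_of_base_eq_paramCurve_transport {U V : Matrix (Fin 2) (Fin 2) ℤ}
    (hUV : U * V = 1) (hVU : V * U = 1) (g₀ g₁ : Polynomial ℂ)
    (h : ∀ W' : Set (Fin 2 ⊕ Fin 2 → ℂ), MMCaseDimPiOneFree W' →
      zeroLocus ℂ (vanishingIdeal ℂ (projAdd '' (W' ∩ torusLocus ℂ 2))) =
        {x : Fin 2 → ℂ | ∃ t : ℂ,
          x 0 = (Polynomial.C ((U 0 0 : ℤ) : ℂ) * g₀ + Polynomial.C ((U 0 1 : ℤ) : ℂ) * g₁).eval t ∧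
          x 1 = (Polynomial.C ((U 1 0 : ℤ) : ℂ) * g₀ + Polynomial.C ((U 1 1 : ℤ) : ℂ) * g₁).eval t} →
      UnprojectedDense W')
    {W : Set (Fin 2 ⊕ Fin 2 → ℂ)} (hmm : MMCaseDimPiOneFree W)
    (hbase : zeroLocus ℂ (vanishingIdeal ℂ (projAdd '' (W ∩ torusLocus ℂ 2))) =
      {x : Fin 2 → ℂ | ∃ t : ℂ, x 0 = g₀.eval t ∧ x 1 = g₁.eval t}) :
    UnprojectedDense W :=
  unprojectedDense_of_mmCase_of_base_transport hUV hVU _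
    (fun W' hW' hb' => h W' hW' (by rw [hb', intLinMap_image_paramCurve])) hmm hbase

/-! ## Part B. Rational leading ratio: reduction to unequal degrees by a Bezout matrix -/

section RatRatio

variable (g₀ g₁ : Polynomial ℂ) {p q u v : ℤ}

/-- The rows of `bezoutMat p q u v = (p q; -v u)` applied to `(g₀, g₁)`. (new) -/
theorem bezoutMat_rows_paramCurve :
    (Polynomial.C ((bezoutMat p q u v 0 0 : ℤ) : ℂ) * g₀ +
        Polynomial.C ((bezoutMat p q u v 0 1 : ℤ) : ℂ) * g₁ =
          Polynomial.C (p : ℂ) * g₀ + Polynomial.C (q : ℂ) * g₁) ∧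
      (Polynomial.C ((bezoutMat p q u v 1 0 : ℤ) : ℂ) * g₀ +
        Polynomial.C ((bezoutMat p q u v 1 1 : ℤ) : ℂ) * g₁ =
          Polynomial.C (u : ℂ) * g₁ - Polynomial.C (v : ℂ) * g₀) := by
  refine ⟨by simp [bezoutMat], ?_⟩
  simp only [bezoutMat, Matrix.of_apply, Matrix.cons_val', Matrix.cons_val_zero,
    Matrix.cons_val_one, Matrix.cons_val_fin_one, Int.cast_neg, map_neg]
  ring

/-- **Degree drop.**  `deg g₀ = deg g₁ = n ≥ 1`, `p lc(g₀) + q lc(g₁) = 0` ⟹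
`deg (p g₀ + q g₁) < n`. (new) -/
theorem natDegree_ratRed_lt (hn : 1 ≤ g₀.natDegree) (heq : g₁.natDegree = g₀.natDegree)
    (hpq : (p : ℂ) * g₀.leadingCoeff + (q : ℂ) * g₁.leadingCoeff = 0)
    {G : Polynomial ℂ} (hG : G = Polynomial.C (p : ℂ) * g₀ + Polynomial.C (q : ℂ) * g₁) :
    G.natDegree < g₀.natDegree := by
  subst hG
  have e1 : g₁.coeff g₀.natDegree = g₁.leadingCoeff := by rw [Polynomial.leadingCoeff, heq]
  have hle : (Polynomial.C (p : ℂ) * g₀ + Polynomial.C (q : ℂ) * g₁).natDegree ≤ g₀.natDegree := by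
    refine (Polynomial.natDegree_add_le _ _).trans (max_le ?_ ?_)
    · exact (Polynomial.natDegree_C_mul_le _ _)
    · exact (Polynomial.natDegree_C_mul_le _ _).trans heq.le
  refine lt_of_le_of_ne hle fun h => ?_
  have hcoeff : (Polynomial.C (p : ℂ) * g₀ + Polynomial.C (q : ℂ) * g₁).coeff g₀.natDegree = 0 := by
    rw [Polynomial.coeff_add, Polynomial.coeff_C_mul, Polynomial.coeff_C_mul,
      Polynomial.coeff_natDegree, e1, hpq]
  have hne : Polynomial.C (p : ℂ) * g₀ + Polynomial.C (q : ℂ) * g₁ ≠ 0 := by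
    intro h0
    rw [h0, Polynomial.natDegree_zero] at h
    omega
  have := Polynomial.leadingCoeff_ne_zero.2 hne
  rw [Polynomial.leadingCoeff, h, hcoeff] at this
  exact this rfl

/-- **The second row keeps degree `n`**: `q (u lc₁ - v lc₀) = -(p u + q v) lc₀ = -lc₀ ≠ 0`.
(new) -/
theorem natDegree_ratRed_snd (hbez : p * u + q * v = 1) (hn : 1 ≤ g₀.natDegree)
    (heq : g₁.natDegree = g₀.natDegree)
    (hpq : (p : ℂ) * g₀.leadingCoeff + (q : ℂ) * g₁.leadingCoeff = 0)
    {H : Polynomial ℂ} (hH : H = Polynomial.C (u : ℂ) * g₁ - Polynomial.C (v : ℂ) * g₀) :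
    H.natDegree = g₀.natDegree ∧
      H.leadingCoeff = (u : ℂ) * g₁.leadingCoeff - (v : ℂ) * g₀.leadingCoeff := by
  subst hH
  have hg0 : g₀ ≠ 0 := by rintro rfl; rw [Polynomial.natDegree_zero] at hn; omega
  have hlc0 : g₀.leadingCoeff ≠ 0 := Polynomial.leadingCoeff_ne_zero.2 hg0
  have e1 : g₁.coeff g₀.natDegree = g₁.leadingCoeff := by rw [Polynomial.leadingCoeff, heq]
  have hle : (Polynomial.C (u : ℂ) * g₁ - Polynomial.C (v : ℂ) * g₀).natDegree ≤ g₀.natDegree := by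
    refine (Polynomial.natDegree_sub_le _ _).trans (max_le ?_ ?_)
    · exact (Polynomial.natDegree_C_mul_le _ _).trans heq.le
    · exact (Polynomial.natDegree_C_mul_le _ _)
  have hcoeff : (Polynomial.C (u : ℂ) * g₁ - Polynomial.C (v : ℂ) * g₀).coeff g₀.natDegree =
      (u : ℂ) * g₁.leadingCoeff - (v : ℂ) * g₀.leadingCoeff := by
    rw [Polynomial.coeff_sub, Polynomial.coeff_C_mul, Polynomial.coeff_C_mul,
      Polynomial.coeff_natDegree, e1]
  have hne : (u : ℂ) * g₁.leadingCoeff - (v : ℂ) * g₀.leadingCoeff ≠ 0 := by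
    intro h0
    have hbez' : (p : ℂ) * u + q * v = 1 := by exact_mod_cast hbez
    have : (q : ℂ) * ((u : ℂ) * g₁.leadingCoeff - (v : ℂ) * g₀.leadingCoeff) =
        -g₀.leadingCoeff := by
      linear_combination (u : ℂ) * hpq - g₀.leadingCoeff * hbez'
    rw [h0, mul_zero] at this
    exact hlc0 (neg_eq_zero.1 this.symm)
  have hdeg : (Polynomial.C (u : ℂ) * g₁ - Polynomial.C (v : ℂ) * g₀).natDegree = g₀.natDegree :=
    le_antisymm hle (Polynomial.le_natDegree_of_ne_zero (by rw [hcoeff]; exact hne))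
  exact ⟨hdeg, by rw [Polynomial.leadingCoeff, hdeg, hcoeff]⟩

/-- **REDUCTION BY A BEZOUT MATRIX.**  `p u + q v = 1`; if every `W'` of the case over the curve
`{(G(t), H(t))}`, `G = p g₀ + q g₁`, `H = u g₁ - v g₀`, is dense, then every `W` of the case over
`{(g₀(t), g₁(t))}` is dense. (new) -/
theorem unprojectedDense_of_mmCase_of_base_eq_paramCurve_bezout (hbez : p * u + q * v = 1)
    {G H : Polynomial ℂ} (hG : G = Polynomial.C (p : ℂ) * g₀ + Polynomial.C (q : ℂ) * g₁)
    (hH : H = Polynomial.C (u : ℂ) * g₁ - Polynomial.C (v : ℂ) * g₀)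
    (h : ∀ W' : Set (Fin 2 ⊕ Fin 2 → ℂ), MMCaseDimPiOneFree W' →
      zeroLocus ℂ (vanishingIdeal ℂ (projAdd '' (W' ∩ torusLocus ℂ 2))) =
        {x : Fin 2 → ℂ | ∃ t : ℂ, x 0 = G.eval t ∧ x 1 = H.eval t} →
      UnprojectedDense W')
    {W : Set (Fin 2 ⊕ Fin 2 → ℂ)} (hmm : MMCaseDimPiOneFree W)
    (hbase : zeroLocus ℂ (vanishingIdeal ℂ (projAdd '' (W ∩ torusLocus ℂ 2))) =
      {x : Fin 2 → ℂ | ∃ t : ℂ, x 0 = g₀.eval t ∧ x 1 = g₁.eval t}) :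
    UnprojectedDense W := by
  refine unprojectedDense_of_mmCase_of_base_eq_paramCurve_transport
    (bezoutMat_mul_bezoutInv hbez) (bezoutInv_mul_bezoutMat hbez) g₀ g₁ (fun W' hW' hb' => ?_)
    hmm hbase
  rw [(bezoutMat_rows_paramCurve g₀ g₁ (p := p) (q := q) (u := u) (v := v)).1,
    (bezoutMat_rows_paramCurve g₀ g₁ (p := p) (q := q) (u := u) (v := v)).2, ← hG, ← hH] at hb'
  exact h W' hW' hb'

/-- **RATIONAL LEADING RATIO (master form).**  `deg g₀ = deg g₁ = n ≥ 2` with RATIONAL leading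
ratio, written `p lc(g₀) + q lc(g₁) = 0` for integers `p, q` completed by `p u + q v = 1` (so
`lc(g₁)/lc(g₀) = -p/q`); the reduced pair `G = p g₀ + q g₁` (degree `m < n`), `H = u g₁ - v g₀`
(degree `n`).  If `m ≥ 2` and one of: `m ∤ n`; the phase `Re(lc(H) (i/lc(G))^{n/m}) ≠ 0`; the
sub-leading coefficients are not proportional (`m lc(G) H_{n-1} ≠ n lc(H) G_{m-1}`) — then EVERY
`W ⊆ ℂ² × ℂ²` of Mantova–Masser's case (dim-π-S-1-free) whose base curve is `{(g₀(t), g₁(t))}` has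
Zariski-dense exponential points. [cite: MantovaMasser2023, §1 Further remarks, p. 5 (the
question, open in general)] (new) -/
theorem unprojectedDense_of_mmCase_of_base_eq_paramCurve_of_ratRatio (hbez : p * u + q * v = 1)
    (hn : 2 ≤ g₀.natDegree) (heq : g₁.natDegree = g₀.natDegree)
    (hpq : (p : ℂ) * g₀.leadingCoeff + (q : ℂ) * g₁.leadingCoeff = 0)
    {G H : Polynomial ℂ} (hG : G = Polynomial.C (p : ℂ) * g₀ + Polynomial.C (q : ℂ) * g₁)
    (hH : H = Polynomial.C (u : ℂ) * g₁ - Polynomial.C (v : ℂ) * g₀)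
    (hm : 2 ≤ G.natDegree)
    (hreg : ¬ G.natDegree ∣ g₀.natDegree ∨
      (H.leadingCoeff * (I / G.leadingCoeff) ^ (g₀.natDegree / G.natDegree)).re ≠ 0 ∨
      (G.natDegree : ℂ) * G.leadingCoeff * H.coeff (g₀.natDegree - 1) ≠
        (g₀.natDegree : ℂ) * H.leadingCoeff * G.coeff (G.natDegree - 1))
    {W : Set (Fin 2 ⊕ Fin 2 → ℂ)} (hmm : MMCaseDimPiOneFree W)
    (hbase : zeroLocus ℂ (vanishingIdeal ℂ (projAdd '' (W ∩ torusLocus ℂ 2))) =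
      {x : Fin 2 → ℂ | ∃ t : ℂ, x 0 = g₀.eval t ∧ x 1 = g₁.eval t}) :
    UnprojectedDense W := by
  have hHd := (natDegree_ratRed_snd g₀ g₁ hbez (by omega) heq hpq hH).1
  have hlt : G.natDegree < H.natDegree := by
    rw [hHd]; exact natDegree_ratRed_lt g₀ g₁ (by omega) heq hpq hG
  refine unprojectedDense_of_mmCase_of_base_eq_paramCurve_bezout g₀ g₁ hbez hG hH
    (fun W' hW' hb' => ?_) hmm hbase
  refine unprojectedDense_of_mmCase_of_base_eq_paramCurve_master G H hm (by rw [hHd]; exact hn)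
    (Or.inl ⟨hlt, ?_⟩) hW' hb'
  rw [hHd]
  exact hreg

/-- **RATIONAL LEADING RATIO, unconditional sub-class.**  `deg g₀ = deg g₁ = n ≥ 2`,
`p lc(g₀) + q lc(g₁) = 0`, `p u + q v = 1`, and `m = deg (p g₀ + q g₁) ≥ 2` does NOT divide `n` ⟹
every `W` of Mantova–Masser's case over `{(g₀(t), g₁(t))}` has Zariski-dense exponential points.
[cite: MantovaMasser2023, §1 Further remarks, p. 5 (the question, open in general)] (new) -/
theorem unprojectedDense_of_mmCase_of_base_eq_paramCurve_of_ratRatio_of_not_dvd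
    (hbez : p * u + q * v = 1) (hn : 2 ≤ g₀.natDegree) (heq : g₁.natDegree = g₀.natDegree)
    (hpq : (p : ℂ) * g₀.leadingCoeff + (q : ℂ) * g₁.leadingCoeff = 0)
    {G : Polynomial ℂ} (hG : G = Polynomial.C (p : ℂ) * g₀ + Polynomial.C (q : ℂ) * g₁)
    (hm : 2 ≤ G.natDegree) (hndvd : ¬ G.natDegree ∣ g₀.natDegree)
    {W : Set (Fin 2 ⊕ Fin 2 → ℂ)} (hmm : MMCaseDimPiOneFree W)
    (hbase : zeroLocus ℂ (vanishingIdeal ℂ (projAdd '' (W ∩ torusLocus ℂ 2))) =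
      {x : Fin 2 → ℂ | ∃ t : ℂ, x 0 = g₀.eval t ∧ x 1 = g₁.eval t}) :
    UnprojectedDense W :=
  unprojectedDense_of_mmCase_of_base_eq_paramCurve_of_ratRatio g₀ g₁ hbez hn heq hpq hG rfl hm
    (Or.inl hndvd) hmm hbase

/-- **Mantova–Masser's question, literally, for a rational leading ratio with `m ∤ n`:**
`MMCaseDimPiOneFree W → UnprojectedDense W`. [cite: MantovaMasser2023, §1 Further remarks, p. 5
(the question, open in general)] (new) -/
theorem unprojectedDensityQuestion_of_base_eq_paramCurve_of_ratRatio_of_not_dvd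
    (hbez : p * u + q * v = 1) (hn : 2 ≤ g₀.natDegree) (heq : g₁.natDegree = g₀.natDegree)
    (hpq : (p : ℂ) * g₀.leadingCoeff + (q : ℂ) * g₁.leadingCoeff = 0)
    {G : Polynomial ℂ} (hG : G = Polynomial.C (p : ℂ) * g₀ + Polynomial.C (q : ℂ) * g₁)
    (hm : 2 ≤ G.natDegree) (hndvd : ¬ G.natDegree ∣ g₀.natDegree)
    {W : Set (Fin 2 ⊕ Fin 2 → ℂ)}
    (hbase : zeroLocus ℂ (vanishingIdeal ℂ (projAdd '' (W ∩ torusLocus ℂ 2))) =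
      {x : Fin 2 → ℂ | ∃ t : ℂ, x 0 = g₀.eval t ∧ x 1 = g₁.eval t}) :
    MMCaseDimPiOneFree W → UnprojectedDense W := fun hmm =>
  unprojectedDense_of_mmCase_of_base_eq_paramCurve_of_ratRatio_of_not_dvd g₀ g₁ hbez hn heq hpq hG
    hm hndvd hmm hbase

end RatRatio

/-! ## Part C. Example: every surface of the case over `(x₁ - x₀)³ = x₀²` -/

/-- The curve `(x₁ - x₀)³ = x₀²` is `{(t³, t³ + t²)}` (leading ratio `1`, rational). (new) -/
theorem cubeDiffCurve_eq_paramCurve :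
    {x : Fin 2 → ℂ | (x 1 - x 0) ^ 3 = x 0 ^ 2} =
      {x : Fin 2 → ℂ | ∃ t : ℂ, x 0 = (Polynomial.X ^ 3 : Polynomial ℂ).eval t ∧
        x 1 = (Polynomial.X ^ 3 + Polynomial.X ^ 2 : Polynomial ℂ).eval t} := by
  ext x
  simp only [Set.mem_setOf_eq, Polynomial.eval_pow, Polynomial.eval_X, Polynomial.eval_add]
  constructor
  · intro h
    obtain ⟨s, hs⟩ : ∃ s : ℂ, s = x 1 - x 0 := ⟨_, rfl⟩
    rw [← hs] at h
    by_cases h0 : x 0 = 0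
    · have h1 : s = 0 := by
        have : s ^ 3 = 0 := by rw [h, h0]; ring
        exact pow_eq_zero_iff (by norm_num) |>.1 this
      refine ⟨0, by simp [h0], ?_⟩
      have : x 1 = x 0 := sub_eq_zero.1 (hs ▸ h1)
      rw [this, h0]; ring
    · have hs0 : s ≠ 0 := by
        intro hs0
        apply h0
        have : x 0 ^ 2 = 0 := by rw [← h, hs0]; ring
        exact pow_eq_zero_iff (by norm_num) |>.1 this
      have e2 : (x 0 / s) ^ 2 = s := by
        rw [div_pow, div_eq_iff (pow_ne_zero 2 hs0), ← h]; ring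
      have e3 : (x 0 / s) ^ 3 = x 0 := by
        rw [div_pow, div_eq_iff (pow_ne_zero 3 hs0), h]; ring
      exact ⟨x 0 / s, by rw [e3], by rw [e3, e2, hs]; ring⟩
  · rintro ⟨t, h0, h1⟩
    rw [h1, h0]; ring

/-- `deg (X³ + X²) = 3`. -/
theorem natDegree_X_cube_add_X_sq :
    (Polynomial.X ^ 3 + Polynomial.X ^ 2 : Polynomial ℂ).natDegree = 3 := by
  compute_degree!

/-- `lc (X³ + X²) = 1`. -/
theorem leadingCoeff_X_cube_add_X_sq :
    (Polynomial.X ^ 3 + Polynomial.X ^ 2 : Polynomial ℂ).leadingCoeff = 1 := by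
  rw [Polynomial.leadingCoeff, natDegree_X_cube_add_X_sq]
  simp [Polynomial.coeff_X_pow]

/-- **Every `W` of Mantova–Masser's case whose base curve is `(x₁ - x₀)³ = x₀²` has Zariski-dense
exponential points** (`{(t³, t³ + t²)}`: `deg = 3 = 3`, leading ratio `1`; `p = 1`, `q = -1`,
`u = 1`, `v = 0`: reduced pair `(G, H) = (-t², t³ + t²)` with `2 ∤ 3`).
[cite: MantovaMasser2023, §1 Further remarks, p. 5 (the question, open in general)] (new) -/
theorem unprojectedDense_of_mmCase_of_base_eq_cubeDiffCurve {W : Set (Fin 2 ⊕ Fin 2 → ℂ)}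
    (hmm : MMCaseDimPiOneFree W)
    (hbase : zeroLocus ℂ (vanishingIdeal ℂ (projAdd '' (W ∩ torusLocus ℂ 2))) =
      {x : Fin 2 → ℂ | (x 1 - x 0) ^ 3 = x 0 ^ 2}) :
    UnprojectedDense W := by
  rw [cubeDiffCurve_eq_paramCurve] at hbase
  have hd3 : (Polynomial.X ^ 3 : Polynomial ℂ).natDegree = 3 := by simp
  have hlc3 : (Polynomial.X ^ 3 : Polynomial ℂ).leadingCoeff = 1 := by simp
  have hG : Polynomial.C ((1 : ℤ) : ℂ) * (Polynomial.X ^ 3 : Polynomial ℂ) +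
      Polynomial.C ((-1 : ℤ) : ℂ) * (Polynomial.X ^ 3 + Polynomial.X ^ 2) = -Polynomial.X ^ 2 := by
    push_cast
    simp only [map_one, map_neg, one_mul, neg_mul]
    ring
  have hG2 : (-Polynomial.X ^ 2 : Polynomial ℂ).natDegree = 2 := by
    rw [Polynomial.natDegree_neg]; simp
  refine unprojectedDense_of_mmCase_of_base_eq_paramCurve_of_ratRatio_of_not_dvd
    (Polynomial.X ^ 3) (Polynomial.X ^ 3 + Polynomial.X ^ 2) (p := 1) (q := -1) (u := 1) (v := 0)
    (by norm_num) (by rw [hd3]; norm_num) (by rw [hd3, natDegree_X_cube_add_X_sq])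
    (by rw [hlc3, leadingCoeff_X_cube_add_X_sq]; push_cast; ring) hG.symm (by rw [hG2])
    (by rw [hG2, hd3]; norm_num) hmm hbase

end Summit.Schanuel.Schanuel.Theorems
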